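import Summits.HubbardSuperconductivity.HubbardSuperconductivity.Theorems.NodalWardXYNodalReductionDefs
import Summits.HubbardSuperconductivity.HubbardSuperconductivity.Theorems.ThermalWedgeTwApproximatingHamiltonianLocality
import Literature.MathematicalPhysics.QuantumLattice.HubbardCommutatorBound

/-!
# Double-commutator form bound: crux `NodalReduction` (stmt-HubbardSuperconductivity-1268), line `Sketch`, stub `stub_doubleCommutatorForm`

Statement (B) `DoubleCommutatorForm` of `NodalWardXYNodalReductionDefs`: for the grand-canonical Hubbard
torus `H = hubbardTorusWith 2 L 1 U μ` and the `d`-wave order operator `O = Δ + Δᴴ`,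
`Δ = pairField dWaveFormFactor L`, the double commutator `[[O,H],O] = (OH - HO)O - O(OH - HO)` has
`Re⟨Φ, [[O,H],O] Φ⟩ ≤ C₂ L²` for every unit vector `Φ`, with `C₂ = C₂(U, μ)` independent of `L`
(Koma–Tasaki, J. Stat. Phys. 76 (1994) 745, eq. (2.9); the input of the Kaplan–Horsch–von der Linden
trial-state argument).

Content. Everything is local, so the operator NORM of the double commutator is `O(L²)`. The argument is
carried out for the Hubbard Hamiltonian `H = H(t,U) - μN` of an arbitrary finite graph of maximal degree
`≤ Δ` and an arbitrary family `o_y`, `y ∈ κ`, of even local operators (`dcf_form_doubleCommutator_le`):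

* `o_y` is an EVEN element of the CAR algebra of a set `W_y` of `≤ w` sites, `‖o_y‖ ≤ M`, and every set
  `S` of sites meets at most `k|S|` of the `W_y`; `O = Σ_y o_y`;
* `[O,H] = Σ_x A_x`, `A_x = o_x H - H o_x`, with `‖A_x‖ ≤ w(2Δ+1) · 2(2|t|+|U|+2|μ|) M` by the tree's
  volume-independent commutator bound `norm_commutator_hamiltonianWith_le` (`HubbardCommutatorBound`);
* LOCALITY of `A_x`: writing `H = Σ_Z h_Z` (`sum_hubbardTermOp`), only the terms meeting `W_x` survive
  in `A_x`, so `A_x` lies in the CAR algebra of `S_x = W_x ∪ ⋃_{Z ∩ W_x ≠ ∅} supp Z`, a set of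
  `≤ w(1 + 2(2Δ+1))` sites (`dcf_commutator_hamiltonianWith_mem`, `dcf_card_spread_le`);
* the KEY LEMMA `dcf_norm_commutator_sum_le` (the proof of `norm_commutator_hamiltonianWith_le` with
  the roles of `H` and the local observable exchanged): for `X` in the CAR algebra of the sites `S`,
  `‖O X - X O‖ ≤ |T| · 2M‖X‖` whenever `W_y ∩ S ≠ ∅ ⇒ y ∈ T`, because the even `o_y` commute with `X` as
  soon as `W_y ∩ S = ∅` (graded locality, `commute_of_mem_carEvenSubalgebra`, Bratteli–Robinson II
  §5.2.2);
* hence `‖[[O,H],O]‖ ≤ Σ_x ‖O A_x - A_x O‖ ≤ |κ| · k w(1+2(2Δ+1)) · 2M · w(2Δ+1) · 2(2|t|+|U|+2|μ|) M`,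
  and `Re⟨Φ, XΦ⟩ ≤ ‖X‖` for unit `Φ` (`norm_star_dotProduct_mulVec_le`).

On the torus `(ℤ/Lℤ)²` (`κ = Λ_L`, `|κ| = L²`, `Δ = 4`): `o_x = P_x + P_xᴴ` with
`P_x = localPair g L x = Σ_e (g e/√2) b_{x̄, (x+e)‾}` (`localPair_eq_sum_bondPair`) is even and localised
on `W_x = {(x + e)‾ : e ∈ {0, ±e₁, ±e₂}}` (`w = 5`; support bookkeeping of the tree file
`Theorems/ThermalWedgeTwApproximatingHamiltonianLocality.lean`: `twAhm_localPair_mem_carEvenSubalgebra`,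
`twAhm_card_supp_le`, `twAhm_card_steps_le`, `twAhm_card_torusSite`), `‖o_x‖ ≤ M = 4 Σ_e |g e/√2|`, and
`W_y ∋ w̄'` forces `y = w' - e`, so `k = 5`.

Sources: T. Koma, H. Tasaki, J. Stat. Phys. 76 (1994) 745, (2.9); M. B. Hastings, T. Koma, CMP 265 (2006)
781, App. A; O. Bratteli, D. W. Robinson, *Operator Algebras and Quantum Statistical Mechanics II*,
§5.2.2. Design: no definitions; all CAR-algebra membership reasoning is done for a generic site type
`Λ` (as in `FermionLiebRobinson.lean`) and only instantiated on the torus, whose concrete `DecidableEq`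
instance differs from the one carried by `LinearOrder (FermionTorus 2 L)`; all constants are crude.
-/

noncomputable section

-- `Summit.HubbardSuperconductivity.HubbardSuperconductivity.…` is the tree's summit/sub-problem namespace (D-0017).
set_option linter.dupNamespace false

namespace Summit.HubbardSuperconductivity.HubbardSuperconductivity.Theorems.NodalReduction

open Matrix Finset
open Literature.MathematicalPhysics.QuantumLattice Literature.Probability.LatticeModels
open Literature.Barriers.HubbardSuperconductivity
open scoped Matrix.Norms.L2Operator ComplexOrder

/-! ### Graded locality in the CAR algebra of a finite graph -/

section General

variable {Λ : Type*} [LinearOrder Λ] [Fintype Λ]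

/-- A weighted sum of bond pairs `P = Σ_{e ∈ s} c_e b_{u, v_e}` (the shape of `localPair_eq_sum_bondPair`)
plus its adjoint has norm at most `2 · 2 Σ_e |c_e|` (`‖b_{uv}‖ ≤ 2`, the adjoint has the same norm). -/
theorem dcf_norm_sum_smul_bondPair_add_le {ε : Type*} (s : Finset ε) (c : ε → ℝ) (u : Λ) (v : ε → Λ) :
    ‖(∑ e ∈ s, ((c e : ℝ) : ℂ) • (bondPair u (v e) : Matrix (Finset (Orb Λ)) (Finset (Orb Λ)) ℂ)) +
        (∑ e ∈ s, ((c e : ℝ) : ℂ) • (bondPair u (v e) : Matrix (Finset (Orb Λ)) (Finset (Orb Λ)) ℂ))ᴴ‖ ≤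
      2 * (2 * ∑ e ∈ s, |c e|) := by
  have h : ‖∑ e ∈ s, ((c e : ℝ) : ℂ) • (bondPair u (v e) : Matrix (Finset (Orb Λ)) (Finset (Orb Λ)) ℂ)‖ ≤
      2 * ∑ e ∈ s, |c e| := by
    rw [Finset.mul_sum]
    refine (norm_sum_le _ _).trans (Finset.sum_le_sum fun e _ => ?_)
    rw [norm_smul, Complex.norm_real, Real.norm_eq_abs, mul_comm]
    exact mul_le_mul_of_nonneg_right (norm_bondPair_le_two _ _) (abs_nonneg _)
  calc _ ≤ ‖∑ e ∈ s, ((c e : ℝ) : ℂ) • (bondPair u (v e) : Matrix (Finset (Orb Λ)) (Finset (Orb Λ)) ℂ)‖ +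
        ‖(∑ e ∈ s, ((c e : ℝ) : ℂ) • (bondPair u (v e) : Matrix (Finset (Orb Λ)) (Finset (Orb Λ)) ℂ))ᴴ‖ :=
        norm_add_le _ _
    _ = 2 * ‖∑ e ∈ s, ((c e : ℝ) : ℂ) • (bondPair u (v e) : Matrix (Finset (Orb Λ)) (Finset (Orb Λ)) ℂ)‖ := by
        rw [l2_opNorm_conjTranspose]; ring
    _ ≤ 2 * (2 * ∑ e ∈ s, |c e|) := by gcongr

/-- **Key lemma (graded locality bound).** Let `o_y` be even elements of the CAR algebras of the site
sets `W_y`, of norm `≤ M`, let `X` lie in the CAR algebra of the sites `S`, and let `T` contain every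
`y` whose `W_y` meets `S`. Then `‖(Σ_{y ∈ s} o_y) X - X (Σ_{y ∈ s} o_y)‖ ≤ |T| · 2M‖X‖`: the `o_y` with
`W_y ∩ S = ∅` commute with `X` (Bratteli–Robinson II §5.2.2). Mirror image of
`norm_commutator_hamiltonianWith_le`. -/
theorem dcf_norm_commutator_sum_le {κ : Type*} (s T : Finset κ)
    (o : κ → Matrix (Finset (Orb Λ)) (Finset (Orb Λ)) ℂ) (W : κ → Finset Λ)
    (ho : ∀ y, o y ∈ carEvenSubalgebra (orbSet (W y))) {M : ℝ} (hM₀ : 0 ≤ M) (hM : ∀ y, ‖o y‖ ≤ M)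
    {S : Finset Λ} (hT : ∀ y, ¬ Disjoint (W y) S → y ∈ T)
    {X : Matrix (Finset (Orb Λ)) (Finset (Orb Λ)) ℂ} (hX : X ∈ carSubalgebra (orbSet S)) :
    ‖(∑ y ∈ s, o y) * X - X * ∑ y ∈ s, o y‖ ≤ T.card * (2 * M * ‖X‖) := by
  classical
  rw [finset_sum_commutator]
  -- only the terms indexed by `T` survive
  have hvanish : ∀ y, y ∉ T → o y * X - X * o y = 0 := fun y hy =>
    sub_eq_zero.mpr (commute_of_mem_carEvenSubalgebra (ho y) hX
      (disjoint_orbSet (not_not.mp fun hd => hy (hT y hd)))).eq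
  rw [← Finset.sum_filter_of_ne (p := fun y => y ∈ T)
    (fun y _ hne => not_not.mp fun hy => hne (hvanish y hy))]
  have hterm : ∀ y, ‖o y * X - X * o y‖ ≤ 2 * M * ‖X‖ := fun y => by
    calc ‖o y * X - X * o y‖ ≤ ‖o y * X‖ + ‖X * o y‖ := norm_sub_le _ _
      _ ≤ ‖o y‖ * ‖X‖ + ‖X‖ * ‖o y‖ := add_le_add (norm_mul_le _ _) (norm_mul_le _ _)
      _ = 2 * ‖o y‖ * ‖X‖ := by ring
      _ ≤ 2 * M * ‖X‖ := by gcongr; exact hM y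
  have hcard : (s.filter fun y => y ∈ T).card ≤ T.card :=
    Finset.card_le_card fun y hy => (Finset.mem_filter.1 hy).2
  calc ‖∑ y ∈ s.filter (fun y => y ∈ T), (o y * X - X * o y)‖
      ≤ ∑ y ∈ s.filter (fun y => y ∈ T), ‖o y * X - X * o y‖ := norm_sum_le _ _
    _ ≤ ∑ _y ∈ s.filter (fun y => y ∈ T), 2 * M * ‖X‖ := Finset.sum_le_sum fun y _ => hterm y
    _ = (s.filter fun y => y ∈ T).card * (2 * M * ‖X‖) := by rw [Finset.sum_const, nsmul_eq_mul]
    _ ≤ T.card * (2 * M * ‖X‖) := by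
        have hnn : 0 ≤ 2 * M * ‖X‖ := by positivity
        exact mul_le_mul_of_nonneg_right (by exact_mod_cast hcard) hnn

/-- `Re⟨Φ, XΦ⟩ ≤ ‖X‖` for a unit vector `Φ` (`L²` operator norm; Cauchy–Schwarz). -/
theorem dcf_re_star_dotProduct_mulVec_le {n : Type*} [Fintype n] [DecidableEq n] {Φ : n → ℂ}
    (hΦ : star Φ ⬝ᵥ Φ = 1) (X : Matrix n n ℂ) : (star Φ ⬝ᵥ (X *ᵥ Φ)).re ≤ ‖X‖ := by
  have h := norm_star_dotProduct_mulVec_le X Φ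
  rw [hΦ, Complex.one_re, mul_one] at h
  exact (Complex.re_le_norm _).trans h

/-- Assembly of the double commutator of a sum `O = Σ_x o_x` with `H`:
`[[O,H],O] = Σ_x (A_x O - O A_x)`, `A_x = o_x H - H o_x`, so a uniform bound `‖O A_x - A_x O‖ ≤ K`
gives `‖[[O,H],O]‖ ≤ |κ| K`. -/
theorem dcf_norm_doubleCommutator_sum_le {n κ : Type*} [Fintype n] [DecidableEq n] [Fintype κ]
    (o : κ → Matrix n n ℂ) (H : Matrix n n ℂ) {K : ℝ}
    (hK : ∀ x, ‖(∑ y, o y) * (o x * H - H * o x) - (o x * H - H * o x) * ∑ y, o y‖ ≤ K) :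
    ‖((∑ y, o y) * H - H * ∑ y, o y) * (∑ y, o y) - (∑ y, o y) * ((∑ y, o y) * H - H * ∑ y, o y)‖ ≤
      Fintype.card κ * K := by
  have h1 : (∑ y, o y) * H - H * ∑ y, o y = ∑ x, (o x * H - H * o x) := finset_sum_commutator _ _ _
  rw [h1, finset_sum_commutator]
  calc ‖∑ x, ((o x * H - H * o x) * (∑ y, o y) - (∑ y, o y) * (o x * H - H * o x))‖
      ≤ ∑ x, ‖(o x * H - H * o x) * (∑ y, o y) - (∑ y, o y) * (o x * H - H * o x)‖ := norm_sum_le _ _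
    _ ≤ ∑ _x : κ, K := Finset.sum_le_sum fun x _ => by rw [← norm_neg, neg_sub]; exact hK x
    _ = Fintype.card κ * K := by rw [Finset.sum_const, Finset.card_univ, nsmul_eq_mul]

variable (G : SimpleGraph Λ) [DecidableRel G.Adj]

/-- **Locality of `[A, H]`.** For `A` in the CAR algebra of the sites `W`, the commutator
`A H - H A` with `H = H(t,U) - μN = Σ_Z h_Z` lies in the CAR algebra of
`W ∪ ⋃ {supp Z : supp Z ∩ W ≠ ∅}`: the terms not meeting `W` commute with `A`
(`commute_hubbardTermOp_of_disjoint`). -/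
theorem dcf_commutator_hamiltonianWith_mem (t U μ : ℝ) {W : Finset Λ}
    {A : Matrix (Finset (Orb Λ)) (Finset (Orb Λ)) ℂ} (hA : A ∈ carSubalgebra (orbSet W)) :
    A * hamiltonianWith G t U μ - hamiltonianWith G t U μ * A ∈
      carSubalgebra (orbSet (W ∪ (Finset.univ.filter fun Z : HubbardIdx G =>
        ¬ Disjoint (hubbardTermSupp G Z) W).biUnion (hubbardTermSupp G))) := by
  classical
  have hsum : A * hamiltonianWith G t U μ - hamiltonianWith G t U μ * A =
      ∑ Z ∈ Finset.univ.filter (fun Z : HubbardIdx G => ¬ Disjoint (hubbardTermSupp G Z) W),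
        (A * hubbardTermOp G t U μ Z - hubbardTermOp G t U μ Z * A) := by
    rw [← sum_hubbardTermOp G t U μ, Finset.mul_sum, Finset.sum_mul, ← Finset.sum_sub_distrib]
    refine (Finset.sum_filter_of_ne (p := fun Z : HubbardIdx G => ¬ Disjoint (hubbardTermSupp G Z) W)
      fun Z _ hne hdis => hne ?_).symm
    exact sub_eq_zero.mpr (commute_hubbardTermOp_of_disjoint G t U μ Z hA hdis).eq.symm
  rw [hsum]
  refine Subalgebra.sum_mem _ fun Z hZ => ?_
  -- `orbSet` is monotone
  have hW : orbSet W ⊆ orbSet (W ∪ (Finset.univ.filter fun Z : HubbardIdx G =>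
      ¬ Disjoint (hubbardTermSupp G Z) W).biUnion (hubbardTermSupp G)) := fun _ hk =>
    mem_orbSet.2 (Finset.subset_union_left (mem_orbSet.1 hk))
  have hZ' : orbSet (hubbardTermSupp G Z) ⊆ orbSet (W ∪ (Finset.univ.filter fun Z : HubbardIdx G =>
      ¬ Disjoint (hubbardTermSupp G Z) W).biUnion (hubbardTermSupp G)) := fun _ hk =>
    mem_orbSet.2 (((Finset.subset_biUnion_of_mem (hubbardTermSupp G) hZ).trans
      Finset.subset_union_right) (mem_orbSet.1 hk))
  have hA' := carSubalgebra_mono hW hA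
  have hh := carSubalgebra_mono hZ'
    (carEvenSubalgebra_le_carSubalgebra _ (hubbardTermOp_mem_carEvenSubalgebra G t U μ Z))
  exact Subalgebra.sub_mem _ (Subalgebra.mul_mem _ hA' hh) (Subalgebra.mul_mem _ hh hA')

/-- The spread set `W ∪ ⋃ {supp Z : supp Z ∩ W ≠ ∅}` has at most `|W| (1 + 2(2Δ+1))` sites on a graph
of maximal degree `≤ Δ` (`card_filter_not_disjoint_hubbardTermSupp_le`, supports have `≤ 2` sites). -/
theorem dcf_card_spread_le {Δ : ℕ} (hΔ : ∀ x : Λ, (Finset.univ.filter fun y => G.Adj x y).card ≤ Δ)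
    (W : Finset Λ) :
    (W ∪ (Finset.univ.filter fun Z : HubbardIdx G => ¬ Disjoint (hubbardTermSupp G Z) W).biUnion
      (hubbardTermSupp G)).card ≤ W.card * (1 + 2 * (2 * Δ + 1)) := by
  classical
  have hsupp : ∀ Z : HubbardIdx G, (hubbardTermSupp G Z).card ≤ 2 := fun Z => by
    cases Z with
    | inl p => exact (Finset.card_insert_le _ _).trans (by simp)
    | inr x => simp [hubbardTermSupp]
  have hc := card_filter_not_disjoint_hubbardTermSupp_le G hΔ W
  calc (W ∪ (Finset.univ.filter fun Z : HubbardIdx G => ¬ Disjoint (hubbardTermSupp G Z) W).biUnion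
        (hubbardTermSupp G)).card
      ≤ W.card + ((Finset.univ.filter fun Z : HubbardIdx G =>
          ¬ Disjoint (hubbardTermSupp G Z) W).biUnion (hubbardTermSupp G)).card :=
        Finset.card_union_le _ _
    _ ≤ W.card + ∑ Z ∈ Finset.univ.filter (fun Z : HubbardIdx G => ¬ Disjoint (hubbardTermSupp G Z) W),
          (hubbardTermSupp G Z).card := Nat.add_le_add_left Finset.card_biUnion_le _
    _ ≤ W.card + ∑ _Z ∈ Finset.univ.filter (fun Z : HubbardIdx G =>
          ¬ Disjoint (hubbardTermSupp G Z) W), 2 :=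
        Nat.add_le_add_left (Finset.sum_le_sum fun Z _ => hsupp Z) _
    _ = W.card + (Finset.univ.filter fun Z : HubbardIdx G =>
          ¬ Disjoint (hubbardTermSupp G Z) W).card * 2 := by
        rw [Finset.sum_const, smul_eq_mul]
    _ ≤ W.card + W.card * (2 * Δ + 1) * 2 := Nat.add_le_add_left (Nat.mul_le_mul_right _ hc) _
    _ = W.card * (1 + 2 * (2 * Δ + 1)) := by ring

/-- **The double-commutator bound on a finite graph** (Koma–Tasaki 1994, (2.9), abstract form). On a graph
of maximal degree `≤ Δ`, let `o_y` (`y ∈ κ`) be even elements of the CAR algebras of site sets `W_y` of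
`≤ w` sites, `‖o_y‖ ≤ M`, such that every set `S` of sites meets at most `k|S|` of the `W_y`; put
`O = Σ_y o_y`, `H = H(t,U) - μN`. Then for every unit vector `Φ`,
`Re⟨Φ, [[O,H],O] Φ⟩ ≤ |κ| · k w (1+2(2Δ+1)) · 2M · w(2Δ+1) · 2(2|t|+|U|+2|μ|) M`. -/
theorem dcf_form_doubleCommutator_le {κ : Type*} [Fintype κ] {Δ w k : ℕ}
    (hΔ : ∀ x : Λ, (Finset.univ.filter fun y => G.Adj x y).card ≤ Δ) (t U μ : ℝ)
    (o : κ → Matrix (Finset (Orb Λ)) (Finset (Orb Λ)) ℂ) (W : κ → Finset Λ)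
    (ho : ∀ y, o y ∈ carEvenSubalgebra (orbSet (W y))) {M : ℝ} (hM₀ : 0 ≤ M) (hM : ∀ y, ‖o y‖ ≤ M)
    (hW : ∀ y, (W y).card ≤ w)
    (hcount : ∀ S : Finset Λ, ∃ T : Finset κ, T.card ≤ k * S.card ∧ ∀ y, ¬ Disjoint (W y) S → y ∈ T)
    (Φ : Finset (Orb Λ) → ℂ) (hΦ : star Φ ⬝ᵥ Φ = 1) :
    (star Φ ⬝ᵥ ((((∑ y, o y) * hamiltonianWith G t U μ - hamiltonianWith G t U μ * ∑ y, o y) * (∑ y, o y) -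
        (∑ y, o y) * ((∑ y, o y) * hamiltonianWith G t U μ - hamiltonianWith G t U μ * ∑ y, o y)) *ᵥ Φ)).re ≤
      Fintype.card κ * (((k * (w * (1 + 2 * (2 * Δ + 1))) : ℕ) : ℝ) *
        (2 * M * (((w * (2 * Δ + 1) : ℕ) : ℝ) * (2 * (2 * |t| + |U| + 2 * |μ|) * M)))) := by
  refine (dcf_re_star_dotProduct_mulVec_le hΦ _).trans
    (dcf_norm_doubleCommutator_sum_le o (hamiltonianWith G t U μ) fun x => ?_)
  -- locality of `A_x = o_x H - H o_x`
  have hA := dcf_commutator_hamiltonianWith_mem G t U μ ((carEvenSubalgebra_le_carSubalgebra _) (ho x))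
  obtain ⟨T, hTcard, hT⟩ := hcount (W x ∪ (Finset.univ.filter fun Z : HubbardIdx G =>
      ¬ Disjoint (hubbardTermSupp G Z) (W x)).biUnion (hubbardTermSupp G))
  have hS := dcf_card_spread_le G hΔ (W x)
  -- the key lemma
  refine (dcf_norm_commutator_sum_le Finset.univ T o W ho hM₀ hM hT hA).trans ?_
  -- the norm of `A_x`
  have hAn := norm_commutator_hamiltonianWith_le G hΔ t U μ ((carEvenSubalgebra_le_carSubalgebra _) (ho x))
  rw [← norm_neg, neg_sub] at hAn
  have hJ : 0 ≤ 2 * (2 * |t| + |U| + 2 * |μ|) := by positivity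
  have hc : (((W x).card * (2 * Δ + 1) : ℕ) : ℝ) ≤ ((w * (2 * Δ + 1) : ℕ) : ℝ) := by
    exact_mod_cast Nat.mul_le_mul_right _ (hW x)
  have hAn' := hAn.trans (mul_le_mul hc (mul_le_mul_of_nonneg_left (hM x) hJ) (by positivity)
    (by positivity))
  have hTc : (T.card : ℝ) ≤ ((k * (w * (1 + 2 * (2 * Δ + 1))) : ℕ) : ℝ) := by
    exact_mod_cast hTcard.trans (Nat.mul_le_mul_left k (hS.trans (Nat.mul_le_mul_right _ (hW x))))
  exact mul_le_mul hTc (mul_le_mul_of_nonneg_left hAn' (by positivity)) (by positivity) (by positivity)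

end General

/-! ### The local order operators on the torus `(ℤ/Lℤ)²` -/

section Torus

variable (g : Site 2 → ℝ) (L : ℕ) [NeZero L]

/-- The local order operator `o_x = P_x + P_xᴴ` is an even element of the CAR algebra of the sites
`W_x = {(x + e)‾ : e ∈ {0, ±e₁, ±e₂}}` (`twAhm_localPair_mem_carEvenSubalgebra` and its adjoint). -/
theorem dcf_localPair_add_conjTranspose_mem (x : TorusSite 2 L) :
    localPair g L x + (localPair g L x)ᴴ ∈ carEvenSubalgebra (orbSet
      ((insert (0 : Site 2) unitSteps).image fun e => FermionTorus.ofTorusSite (x + Torus.proj L e))) :=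
  add_mem (twAhm_localPair_mem_carEvenSubalgebra L g x)
    (twAhm_localPair_conjTranspose_mem_carEvenSubalgebra L g x)

/-- If `W_y` meets a set `S` of torus sites then `y = w̄ - e` for some `w ∈ S`, `e ∈ {0, ±e₁, ±e₂}`
(`FermionTorus.toTorusSite ∘ ofTorusSite = id`). -/
theorem dcf_mem_biUnion_of_not_disjoint (S : Finset (FermionTorus 2 L)) (y : TorusSite 2 L)
    (hy : ¬ Disjoint
      ((insert (0 : Site 2) unitSteps).image fun e => FermionTorus.ofTorusSite (y + Torus.proj L e)) S) :
    y ∈ (insert (0 : Site 2) unitSteps).biUnion fun e =>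
      S.image fun w => FermionTorus.toTorusSite w - Torus.proj L e := by
  obtain ⟨w, hwW, hwS⟩ := Finset.not_disjoint_iff.1 hy
  obtain ⟨e, he, rfl⟩ := Finset.mem_image.1 hwW
  refine Finset.mem_biUnion.2 ⟨e, he, Finset.mem_image.2 ⟨_, hwS, ?_⟩⟩
  rw [FermionTorus.toTorusSite_ofTorusSite, add_sub_cancel_right]

omit [NeZero L] in
/-- The set of such `y` has at most `5|S|` elements. -/
theorem dcf_card_biUnion_le (S : Finset (FermionTorus 2 L)) :
    ((insert (0 : Site 2) unitSteps).biUnion fun e =>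
      S.image fun w => FermionTorus.toTorusSite w - Torus.proj L e).card ≤ 5 * S.card :=
  calc _ ≤ ∑ e ∈ insert (0 : Site 2) unitSteps,
        (S.image fun w => FermionTorus.toTorusSite w - Torus.proj L e).card := Finset.card_biUnion_le
    _ ≤ ∑ _e ∈ insert (0 : Site 2) unitSteps, S.card := Finset.sum_le_sum fun e _ => Finset.card_image_le
    _ = (insert (0 : Site 2) unitSteps).card * S.card := by rw [Finset.sum_const, smul_eq_mul]
    _ ≤ 5 * S.card := Nat.mul_le_mul_right _ twAhm_card_steps_le

/-- Hence every set `S` of torus sites meets at most `5|S|` of the `W_y`. -/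
theorem dcf_count (S : Finset (FermionTorus 2 L)) :
    ∃ T : Finset (TorusSite 2 L), T.card ≤ 5 * S.card ∧ ∀ y : TorusSite 2 L, ¬ Disjoint
      ((insert (0 : Site 2) unitSteps).image fun e => FermionTorus.ofTorusSite (y + Torus.proj L e)) S →
        y ∈ T :=
  ⟨_, dcf_card_biUnion_le L S, fun y hy => dcf_mem_biUnion_of_not_disjoint L S y hy⟩

/-- `O = Δ + Δᴴ = Σ_x (P_x + P_xᴴ)`. -/
theorem dcf_pairField_add_conjTranspose_eq :
    pairField g L + (pairField g L)ᴴ = ∑ x : TorusSite 2 L, (localPair g L x + (localPair g L x)ᴴ) := by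
  rw [pairField, conjTranspose_sum, ← Finset.sum_add_distrib]

end Torus

/-- **(B) `DoubleCommutatorForm`**: `Re⟨Φ, [[O,H],O] Φ⟩ ≤ C₂(U,μ) L²` for unit `Φ`, `O = Δ_d + Δ_dᴴ`,
`H = hubbardTorusWith 2 L 1 U μ` (Koma–Tasaki 1994, (2.9)): `dcf_form_doubleCommutator_le` on the torus
graph (degree `≤ 4`, `SourceGas.card_filter_fermionTorusGraph_adj_le`) with `o_x = P_x + P_xᴴ`,
`w = k = 5`, `M = 4 Σ_e |d e/√2|`, and `|Λ_L| = L²`. -/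
theorem stub_doubleCommutatorForm : DoubleCommutatorForm := by
  intro U μ
  refine ⟨(((5 * (5 * (1 + 2 * (2 * 4 + 1)))) : ℕ) : ℝ) *
      (2 * (2 * (2 * ∑ e ∈ insert (0 : Site 2) unitSteps, |dWaveFormFactor e / Real.sqrt 2|)) *
        (((5 * (2 * 4 + 1) : ℕ) : ℝ) * (2 * (2 * |(1 : ℝ)| + |U| + 2 * |μ|) *
          (2 * (2 * ∑ e ∈ insert (0 : Site 2) unitSteps, |dWaveFormFactor e / Real.sqrt 2|))))),
    fun L _ Φ hΦ => ?_⟩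
  dsimp only
  rw [dcf_pairField_add_conjTranspose_eq, hubbardTorusWith]
  have hM₀ : (0 : ℝ) ≤ 2 * (2 * ∑ e ∈ insert (0 : Site 2) unitSteps, |dWaveFormFactor e / Real.sqrt 2|) :=
    mul_nonneg zero_le_two (mul_nonneg zero_le_two (Finset.sum_nonneg fun _ _ => abs_nonneg _))
  have h := dcf_form_doubleCommutator_le (fermionTorusGraph 2 L) (Δ := 4)
    (fun x => SourceGas.card_filter_fermionTorusGraph_adj_le x) 1 U μ
    (fun y : TorusSite 2 L => localPair dWaveFormFactor L y + (localPair dWaveFormFactor L y)ᴴ)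
    (fun y : TorusSite 2 L => (insert (0 : Site 2) unitSteps).image fun e =>
      FermionTorus.ofTorusSite (y + Torus.proj L e))
    (dcf_localPair_add_conjTranspose_mem dWaveFormFactor L) hM₀
    (fun y => by
      rw [localPair_eq_sum_bondPair]
      exact dcf_norm_sum_smul_bondPair_add_le _ _ _ _)
    (twAhm_card_supp_le L) (dcf_count L) Φ hΦ
  refine h.trans (le_of_eq ?_)
  rw [twAhm_card_torusSite, mul_comm]

end Summit.HubbardSuperconductivity.HubbardSuperconductivity.Theorems.NodalReduction

end
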